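import Summits.CriticalPhenomena.PercolationContinuityZ3.Theorems.Transplant.SkelPhiFaceKitsGFVC
import Summits.CriticalPhenomena.PercolationContinuityZ3.Theorems.Transplant.SkelPhiFaceKitsGFCQ
import HarnessLib
/-!
# WAVE-Q binder row «SkelPhiFaceKitsGFVC» ↦ «SkelPhiFaceKitsGFVCQ» (quasi-step rung (N3-b); captain gen-1 g4, WAVE-Q-BINDER-rows v0.7/v0.8, row Q46, FLOOR row; family stmt-g33 = «SkelPhiCorridor*» / «SkelPhiFace*»):
# **THE FORCED KIT CLAUSE OF ONE LEVEL OF THE FACE STEP `faceStepWNbV` (staggered `PCells2V` cells), UNDER EXACT-FOOTPRINT QUASI-STEPS** — `Skelφ.hkits_faceStepWNbFVCQ`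

builds on p205010 (kernel theorem, internal audit signed; external expert review pending) — nothing in this file uses p205010; nothing here is a claim about any open node (the
quasi-step node's statement, name and wording are a lead's).  Lane `prim-bschramm`, seat `prim-bschramm-stmt` gen 33 (port pen).  Helper file (`--supports stmt-CriticalPhenomena-4575 --as helper`);
def-free.  PORT RULES (captain #6109/#6122 hunk classes + R-1 = L-hp8-1 (b), R-2 port-only-in-cone): twin of the ONE in-cone `hstep`-threading declaration of the tree module «SkelPhiFaceKitsGFVC»
(sha256 1ccd7cb4f268ae99…, imported: its Steps-free §1 `winLevel_subset_stepRg_faceStepWNbV` / `far_mem_faceStepWNb_TV` are USED, not re-declared; its first-section `hkits_faceStepWNbV` calls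
the census-EXTERNAL `hkits_face_of_route` («SkelPhiFaceKitsG») and is NOT twinned), statement and proof BYTE-IDENTICAL except: (i) `(hstep : Steps G φ) ↦ {Mq : ℕ} (hqφ : Skelφ.QStepsN G φ Mq)`
(named `Mq` because the window half-width is already called `M`), with the FACE-FRAME cost floor `hPN : 3 ≤ PA.N ↦ 3·Mq ≤ PA.N` (gen-1 g4's `FinePrm.qStepsN_frame_q`, consumed inside
`FinePrm.hkits_face_of_routeFCQ`); (ii) `FinePrm.hkits_face_of_routeFC ↦ …FCQ` («SkelPhiFaceKitsGFCQ» Q40, this seat); (iv) FLOOR tokens (p5-g28's pull list): `KCmax ↦ PA.N·KCmax` in `hMD`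
(`shellD + 1 + d + PA.N·KCmax + Rs ≤ 2M + 2`), `hT'`, `hr₀`, `hrs`, `hE`, `hreach` (and the derived `hDw`/`hE'` in the proof), `KCmax + 1 ↦ (KCmax+1)·(PA.N+2)` in `hcS`.
Regression: `Mq = 1`, `PA.N`-tokens at `qStepsN_of_steps` give the original.  Docstrings and citations are the original's.
-/

noncomputable section

open scoped Classical

namespace Summit.CriticalPhenomena.PercolationContinuityZ3.Theorems.Transplant

namespace Skelφ

open MeasureTheory
open Literature.Probability.Percolation Literature.Probability.LatticeModels SimpleGraph KNLevels GadgetSystem Contour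
open Literature.Barriers.CriticalPhenomena (graphBall graphBall_finite mem_graphBall_self graphBall_mono)
open Skel (winGraph winGraph_adj winGraph_le KitGeom WinStepData)
open SkelI (tanOff tanTgt tanTgt_mem)
open Literature.Probability.Percolation.KozmaNitzan.Cells (oth oth_ne eq_oth_of_ne oth_oth)
open BoxProdZ2 (ConcRadiiG)

variable {V : Type} [DecidableEq V] {G : SimpleGraph V} [G.LocallyFinite] {φ : V → Site 2}

/-- (WAVE-Q twin of `hkits_faceStepWNbFVC` under `QStepsN G φ Mq`; floors ×`PA.N` per the header.) **THE FORCED KIT CLAUSE OF LEVEL `j′ ∈ [M+1, Rlev]` OF THE FACE STEP `faceStepWNbV`** (the `hkits` hypothesis of `faceOblRM_fineNbV`'s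
F-twin at one level; the (S0) twin of `hkits_faceStepWNbG`), from the zone datum rows and a route at accuracy `δ³` at every centre of the
`E`-enlarged level box inside `B(w₀, rE − r)`. [cite: KozmaNitzan2024, §4 Lemma 10 (pp. 17–21), p. 30 (Step III)] [cite: MartineauTassion2017, §4.3 Lemma 4.2] -/
theorem hkits_faceStepWNbFVCQ [Countable V] (hlipφ : Lip G φ) {Mq : ℕ} (hqφ : QStepsN G φ Mq)
 {Δ : ℕ} (hΔ : ∀ v, G.degree v ≤ Δ) {q : unitInterval} {δ : ℝ} (hδ : 0 < δ)
    -- the face frame at the window centre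
    (pr : FinePrm) (w₀ : V) (du : MDir) (b : Fin 2) (hc₀ : 0 < pr.c₀) (hc₁ : 0 < pr.c₁) (hD : 0 < pr.D) (hL0 : pr.c₀ * pr.L 0 ≤ pr.D)
    (hL1 : pr.c₁ * pr.L 1 ≤ pr.D) (hA0 : 0 < pr.A) (hb : |pr.lvGen du.1 (oth b)| ≤ |pr.lvGen du.1 b|)
    (hnz : pr.lvGen du.1 b ≠ 0) {nF : ℕ} (hnC : (nF : ℤ) ≤ pr.cOf du.1 * |pr.A| * |pr.lvGen du.1 b|) (hU3 : pr.D ≤ 3 * (nF : ℤ))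
    -- the face step
    (P : PCells2V) (Λ : ConcRadiiG) (b₀ : Fin 2 → ℕ) (a' : ℕ) (x : Site 2) (j : ℕ) (pc : ℤ) (aw Rlev N M L' : ℕ) (Sfin : Finset V)
    {yF : V} (hyF : pr.ψ φ w₀ yF = P.faceCen x du j) (hpc : pc = relφ φ w₀ yF b) (hjK : j + 1 ≤ P.K) (hRlev : Rlev + 4 ≤ 10 * P.s du.1)
    (hRlev' : (Rlev : ℤ) + 5 + P.c du.1 ≤ 3 * P.r (oth du.1)) {kF : ℤ}
    (hroomF : pr.Mabs * (aw + Rlev + 1) + pr.rdN du.1 b * (Rlev + 2) * pr.D ≤ pr.rdK du.1 b * kF * pr.D) (hkF : kF + 3 + P.c du.1 + P.r (oth du.1) ≤ 5 * P.r (oth du.1))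
    {j' : ℕ} (hj'M : M + 1 ≤ j') (hj'R : j' ≤ Rlev)
    -- kit constants
    (PA : ApronPrm) {nz Rs KCmax rs cS cU E r : ℕ} (hPN : 3 * Mq ≤ PA.N) (hA : PA.A = (nz + 1 : ℕ) * pr.D + 1)
    (hdD : PA.d + 2 ≤ shellD PA) (hDρ : Rs + 1 ≤ shellD PA) (hKCmax : (shellD PA + nz + 1) * 3 ≤ KCmax)
    (hMtan : tanOff PA.ℓs PA.M ≤ (M : ℤ) + 1) (hMd : PA.d + 2 ≤ 2 * M + 2) (hMD : shellD PA + 1 + PA.d + PA.N * KCmax + Rs ≤ 2 * M + 2)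
    (hT' : (shellD PA : ℤ) + PA.N * KCmax + Rs ≤ tanOff PA.ℓs PA.M)
    (hr₀ : PA.N * (tanOff PA.ℓs PA.M + 2) + PA.N * PA.d + (PA.N * KCmax + Rs) ≤ PA.r₀) (hR : PA.r₀ ≤ Λ.rE a' x du)
    (hrs : 1 + (PA.N * (tanOff PA.ℓs PA.M + 2) + PA.N * PA.d + (PA.N * KCmax + Rs)) ≤ rs)
    (hcS : (PA.N + 1) * (tanOff PA.ℓs PA.M + 1) + (PA.N + 1) * PA.d + (KCmax + 1) * (PA.N + 2) + cU ≤ cS)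
    (hE : Rlev + (PA.N * (tanOff PA.ℓs PA.M + 1) + PA.N * PA.d + PA.N * KCmax) ≤ E)
    (hreach : r + (PA.N * (tanOff PA.ℓs PA.M + 1) + PA.N * PA.d + PA.N * KCmax) ≤ PA.r₀)
    (hrim : Λ.rM a' (x + stepVec du) - L' + PA.r₀ ≤ Λ.rE a' x du)
    -- the short region and the zone datum at the kit centres (inside `Rg`, connected, containing the centre and the fat-prism box `cylBallFin c kz Rk`)
    (Rg : V → Finset V) (hRg : ∀ c, ∀ u ∈ Rg c, u ∈ graphBall G c Rs) (hRgcard : ∀ c, (Rg c).card ≤ cU) (hcU1 : 1 ≤ cU)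
    (Λc : V → ℕ → Finset V) (kz : ℕ) (hΛRg : ∀ c, Λc c kz ⊆ Rg c) (hzconn : ∀ c, ∀ s ∈ Λc c kz, PathIn G (↑(Λc c kz) : Set V) c s)
    (hcz : ∀ c, c ∈ Λc c kz)

    (kk : ℕ) {Wt : Sym2 V → unitInterval}
    (hN : kk * (Δ + 1) ^ (2 * rs) ≤ N) (hk : (1 - (q : ℝ) ^ (1 + Δ * cS + cS * cU)) ^ kk ≤ δ)
    -- THE ROUTE at every centre of the enlarged box near the window centre, at accuracy `δ³`
    (hroute : ∀ c, pr.frame φ w₀ du.1 b c ∈ Finset.Icc (loNV P x du j pc aw - ((E : ℕ) : Site 2)) (hiNV P x du j pc aw + ((E : ℕ) : Site 2)) →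
      c ∈ graphBall G w₀ (Λ.rE a' x du - r) →
      ∃ Qt Ft : Finset V, Ft ⊆ (faceStepWNbV G pr φ P w₀ Λ b₀ b a' x du j pc aw Rlev N M L' Sfin).T ∧
        Qt ⊆ stepRg G (pr.frame φ w₀ du.1 b) (faceStepWNbV G pr φ P w₀ Λ b₀ b a' x du j pc aw Rlev N M L' Sfin) ∧
        1 - δ ^ 3 ≤ (prodBernoulli Wt).real (linkIn (↑Qt : Set V) (Λc c kz) Ft)) :
    let Q := faceStepWNbV G pr φ P w₀ Λ b₀ b a' x du j pc aw Rlev N M L' Sfin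
    ∃ (σ : KNLevels.SData V) (Sz : Finset V),
      KNLevels.SHyp (winLData G (pr.frame φ w₀ du.1 b) Q.root Q.Rπ Q.lo Q.hi Q.root Q.Sfin) j' σ ∧ σ.N ≤ Q.N ∧
      (1 - (q : ℝ) ^ σ.sB) ^ σ.k ≤ δ ∧ Sz ⊆ stepRg G (pr.frame φ w₀ du.1 b) Q ∧ (∀ x' ∈ σ.K, σ.face x' ⊆ Sz) ∧
      KNLevels.RelayClause (winLData G (pr.frame φ w₀ du.1 b) Q.root Q.Rπ Q.lo Q.hi Q.root Q.Sfin) Wt j' σ Sz Q.T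
        (stepRg G (pr.frame φ w₀ du.1 b) Q) δ := by
  intro Q
  -- the wide level box
  have hw := loN_hiN_hwideV P x du j pc aw hj'M
  have hwide : ∀ i, (loNV P x du j pc aw - (j' : Site 2)) i + 2 * tanOff PA.ℓs PA.M ≤ (hiNV P x du j pc aw + (j' : Site 2)) i := fun i => by
    have := hw i; linarith
  have hMd' : ((PA.d + 2 : ℕ) : ℤ) ≤ 2 * M + 2 := by exact_mod_cast hMd
  have hMD' : ((shellD PA + 1 + PA.d + PA.N * KCmax + Rs : ℕ) : ℤ) ≤ 2 * M + 2 := by exact_mod_cast hMD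
  have hdw : ∀ i, (loNV P x du j pc aw - (j' : Site 2)) i + (PA.d + 2 : ℕ) ≤ (hiNV P x du j pc aw + (j' : Site 2)) i := fun i => by
    have := hw i; linarith
  have hDw : ∀ i, (loNV P x du j pc aw - (j' : Site 2)) i + ((shellD PA + 1 + PA.d + PA.N * KCmax + Rs : ℕ) : ℤ) ≤ (hiNV P x du j pc aw + (j' : Site 2)) i :=
    fun i => by have := hw i; linarith
  -- the level inside the region; the far part inside the rim
  have hXD : winLevel G (pr.frame φ w₀ du.1 b) w₀ (Λ.rE a' x du) (loNV P x du j pc aw) (hiNV P x du j pc aw) j' ⊆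
      stepRg G (pr.frame φ w₀ du.1 b) Q :=
    winLevel_subset_stepRg_faceStepWNbV G φ P w₀ Λ b₀ a' N M L' Sfin hyF hpc hjK hRlev hRlev' hc₀ hc₁ hD hnz hroomF hkF (by omega)
  have hfarT : ∀ v ∈ winLevel G (pr.frame φ w₀ du.1 b) w₀ (Λ.rE a' x du) (loNV P x du j pc aw) (hiNV P x du j pc aw) j',
      v ∉ graphBall G w₀ (Λ.rE a' x du - PA.r₀) → v ∈ Q.T := fun v hv hfar =>
    far_mem_faceStepWNb_TV G φ pr P w₀ Λ b₀ b a' x du j pc aw Rlev N M L' Sfin hrim (hXD hv) hfar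
  have hE' : j' + (PA.N * (tanOff PA.ℓs PA.M + 1) + PA.N * PA.d + PA.N * KCmax) ≤ E := le_trans (by omega) hE
  exact FinePrm.hkits_face_of_routeFCQ hlipφ hqφ hΔ hδ pr w₀ du.1 b hD hL0 hL1 (pr.cOf_pos hc₀ hc₁ du.1) hA0 hb hnz hnC hU3
    PA hPN hA hdD hDρ hKCmax hwide hdw hDw hT' hr₀ hR hrs hcS hE' hreach Rg hRg hRgcard hcU1 Λc kz hΛRg hzconn hcz
    kk w₀ Sfin hXD hfarT hN hk hroute

end Skelφ

end Summit.CriticalPhenomena.PercolationContinuityZ3.Theorems.Transplant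

end
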